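import Mathlib
import HarnessLib
import Literature.Analysis.FluidPDE.SuitableWeak
import Literature.Analysis.FluidPDE.LocalTypeI
import Literature.Analysis.FluidPDE.SlabPressureNormalization
import Literature.Analysis.FluidPDE.ESSLocalHolderRepresentative
import Literature.Analysis.FluidPDE.NSBoundedHigherRegularityQuantProofs

/-!
# No mild scar under Type I (route RellichScar, item `NoMildScar`): local pressure gauges

Helper file for the proof of `Summit.NavierStokesRegularity.NavierStokesRegularity.Theses.RellichScar.NoMildScar`
(stmt-NavierStokesRegularity-11723).  Albritton–Barker's quantity `𝐈` of a suitable weak solution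
`(u, p)` on the backward slab `(-∞, 0) × ℝ³` controls only the MEAN-FREE pressure
`D(Q(z, r)) = r⁻² ∫_{Q(z,r)} |p − [p]_{B(x,r)}(t)|^{3/2}`, while the regularity theory of bounded
solutions used downstream (the tree's quantitative Serrin theorem
`NSBoundedHigherRegularityBounds_holds`, through `exists_smooth_representative_of_locally_bounded`)
and the weak time-equicontinuity of the pairings (`NSCylinder.exists_fullMeasure_pairing_modulus`)
ask for an `L^{3/2}` bound of the pressure itself on the cylinder at hand.  Since the equations see
the pressure only through `∇p`, the remedy is a LOCAL GAUGE: on each cylinder `Q(z, r)` one works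
with `p − [p]_{B(x,r)}(t)` (KNSS 2009, §1: the pressure is determined up to a function of time),
whose `L^{3/2}(Q(z,r))` norm is exactly `r² D(Q(z,r)) ≤ r² 𝐈`.

* `ballMean_class_of_isCompact`, `IsSuitableWeakSolutionOn.sub_ballMean_slab` — subtracting the
  time-dependent mean over ANY ball keeps a suitable weak solution on the slab (generalising the
  tree's `sub_unitBallMean_slab`);
* `lintegral_sub_ballMean_eq` — `∫_{Q(z,r)} |p − [p]_{B(x,r)}|^{3/2} = r² D(Q(z,r); p)`;
* `exists_smooth_representative_of_locally_bounded_gauge` — the tree's gluing theorem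
  `exists_smooth_representative_of_locally_bounded` with the pressure allowed to depend on the
  covering cylinder (its proof uses the pressure cylinder-wise only);
* `memLp_four_of_apex_bound` — a slice obeying the apex bound `|f(y)| ≤ C/(‖y‖ + s)`, `s > 0`,
  is in `L⁴(ℝ³)` (the class in which the harmonic Liouville theorem is applied downstream).

References: Albritton–Barker 2019 (arXiv:1811.00502), §1 and §3; Koch–Nadirashvili–Seregin–Šverák
2009, §1; Seregin–Šverák 2009, §2 p. 8; Lemarié-Rieusset 2016, proof of Thm. 15.4, Step 2.
-/

noncomputable section

-- the summit and its single sub-problem share the name (CONVENTIONS §1), as in every Theorems file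
set_option linter.dupNamespace false

namespace Summit.NavierStokesRegularity.NavierStokesRegularity.Theorems.RellichScarNoMildScar

open MeasureTheory Set Function Metric Filter Topology TopologicalSpace
open scoped ENNReal NNReal
open Literature.Analysis Literature.Analysis.FluidPDE

local notation "E³" => EuclideanSpace ℝ (Fin 3)

variable {u : ℝ → E³ → E³} {p : ℝ → E³ → ℝ}

/-! ### Means over an arbitrary ball -/

/-- **The ball means of the slab pressure are `L^{3/2}` on compact subsets of the slab**, for an
arbitrary ball `B(x₀, R)` (generalising the tree's `unitBallMean_class_of_isCompact`: Jensen–Tonelli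
on a cylinder `T × B(0, ρ)` of the slab containing both `K` and `T × B(x₀, R)`). [folklore] -/
theorem ballMean_class_of_isCompact
    (hsw : IsSuitableWeakSolutionOn (slab E³ (Iio (0 : ℝ)) isOpen_Iio) 1 0 u p)
    (x₀ : E³) {R : ℝ} (hR : 0 < R)
    {K : Set (ℝ × E³)} (hK : IsCompact K) (hKs : K ⊆ (Iio (0 : ℝ) ×ˢ (univ : Set E³))) :
    AEStronglyMeasurable (fun z : ℝ × E³ => ⨍ y in ball x₀ R, p z.1 y) (volume.restrict K) ∧
      ∫⁻ z in K, ‖⨍ y in ball x₀ R, p z.1 y‖ₑ ^ (3 / 2 : ℝ) < ∞ := by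
  obtain ⟨ρ₀, hρ₀1, hKT, hTc, -⟩ := exists_cylinder_of_isCompact_subset_slab hK hKs
  set T : Set ℝ := Prod.fst '' K with hT
  -- a larger radius containing the ball `B(x₀, R)` as well
  set ρ : ℝ := ρ₀ + ‖x₀‖ + R with hρ
  have hρ₀ρ : ρ₀ ≤ ρ := by rw [hρ]; linarith [norm_nonneg x₀]
  have hBS : ball x₀ R ⊆ ball (0 : E³) ρ := by
    intro y hy
    rw [mem_ball, dist_eq_norm] at hy
    rw [mem_ball_zero_iff]
    calc ‖y‖ = ‖(y - x₀) + x₀‖ := by rw [sub_add_cancel]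
      _ ≤ ‖y - x₀‖ + ‖x₀‖ := norm_add_le _ _
      _ < ρ := by rw [hρ]; linarith
  have hKT' : K ⊆ T ×ˢ ball (0 : E³) ρ := hKT.trans (prod_mono Subset.rfl (ball_subset_ball hρ₀ρ))
  have hTs : T ×ˢ closedBall (0 : E³) ρ ⊆ (Iio (0 : ℝ) ×ˢ (univ : Set E³)) := by
    rintro ⟨t, x⟩ ⟨⟨w, hw, hwt⟩, -⟩
    exact ⟨by rw [← hwt]; exact (hKs hw).1, mem_univ _⟩
  have hsub : T ×ˢ ball (0 : E³) ρ ⊆ T ×ˢ closedBall (0 : E³) ρ :=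
    prod_mono Subset.rfl ball_subset_closedBall
  have hK'c : IsCompact (T ×ˢ closedBall (0 : E³) ρ) := hTc.prod (isCompact_closedBall _ _)
  have hli : LocallyIntegrableOn (uncurry p) (Iio (0 : ℝ) ×ˢ (univ : Set E³)) volume :=
    hsw.distributional.2.2.1
  have hpm : AEStronglyMeasurable (uncurry p) (volume.restrict (T ×ˢ ball (0 : E³) ρ)) :=
    hli.aestronglyMeasurable.mono_measure (Measure.restrict_mono (hsub.trans hTs) le_rfl)
  -- measurability of the means on the cylinder
  have hmeas : AEStronglyMeasurable (fun z : ℝ × E³ => ⨍ y in ball x₀ R, p z.1 y)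
      (volume.restrict (T ×ˢ ball (0 : E³) ρ)) := by
    have hpB : AEStronglyMeasurable (uncurry p)
        ((volume.restrict T).prod (volume.restrict (ball x₀ R))) := by
      rw [← volume_restrict_prod_eq]
      exact hpm.mono_measure (Measure.restrict_mono (prod_mono Subset.rfl hBS) le_rfl)
    have h := hpB.integral_prod_right'
    simp only [uncurry_apply_pair] at h
    have h' : AEStronglyMeasurable (fun t : ℝ => ⨍ y in ball x₀ R, p t y) (volume.restrict T) := by
      simp_rw [setAverage_eq]
      exact h.const_smul ((volume : Measure E³).real (ball x₀ R))⁻¹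
    rw [volume_restrict_prod_eq]
    exact h'.comp_quasiMeasurePreserving Measure.quasiMeasurePreserving_fst
  refine ⟨hmeas.mono_measure (Measure.restrict_mono hKT' le_rfl), ?_⟩
  have hJ := lintegral_enorm_setAverage_slice_rpow_le_of_subset (I := T)
    (measure_ball_lt_top (x := x₀) (r := R)).ne hBS (by norm_num : (1 : ℝ) ≤ 3 / 2) hpm
  refine lt_of_le_of_lt (lintegral_mono_set hKT') (lt_of_le_of_lt hJ ?_)
  refine ENNReal.mul_lt_top (ENNReal.mul_lt_top measure_ball_lt_top
    (ENNReal.inv_lt_top.2 (measure_ball_pos volume x₀ hR))) ?_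
  refine lt_of_le_of_lt (lintegral_mono_set ((prod_mono Subset.rfl hBS).trans hsub)) ?_
  exact hsw.pressure _ hTs hK'c

/-- **Subtracting the time-dependent mean over any ball keeps a suitable weak solution on the
slab** (`IsSuitableWeakSolutionOn.sub_pressure`; the pressure of an ancient solution is determined
only up to a function of time, KNSS 2009, §1). [cite: KNSS2009, §1] -/
theorem sub_ballMean_slab
    (hsw : IsSuitableWeakSolutionOn (slab E³ (Iio (0 : ℝ)) isOpen_Iio) 1 0 u p)
    (x₀ : E³) {R : ℝ} (hR : 0 < R) :
    IsSuitableWeakSolutionOn (slab E³ (Iio (0 : ℝ)) isOpen_Iio) 1 0 u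
      (fun t x => p t x - ⨍ y in ball x₀ R, p t y) := by
  refine hsw.sub_pressure ?_ fun K hKs hK => (ballMean_class_of_isCompact hsw x₀ hR hK hKs).2
  refine (locallyIntegrableOn_iff
    (slab E³ (Iio (0 : ℝ)) isOpen_Iio).isOpen.isLocallyClosed).2 fun K hKs hK => ?_
  obtain ⟨hm, hfin⟩ := ballMean_class_of_isCompact hsw x₀ hR hK hKs
  obtain ⟨h32, h32', h32r⟩ := threeHalves_facts
  haveI : IsFiniteMeasure (volume.restrict K) := ⟨by
    rw [Measure.restrict_apply_univ]; exact hK.measure_lt_top⟩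
  have hmem : MemLp (fun z : ℝ × E³ => ⨍ y in ball x₀ R, p z.1 y) (3 / 2) (volume.restrict K) := by
    refine ⟨hm, ?_⟩
    rw [eLpNorm_eq_lintegral_rpow_enorm_toReal (zero_lt_one.trans_le h32).ne' h32', h32r]
    exact ENNReal.rpow_lt_top_of_nonneg (by positivity) hfin.ne
  exact hmem.integrable h32

/-- **`∫_{Q(z,r)} |p − [p]_{B(x,r)}|^{3/2} = r² D(Q(z,r); p)`** (unfolding `cknDOsc`). [folklore] -/
theorem lintegral_sub_ballMean_eq {r : ℝ} (hr : 0 < r) (z : ℝ × E³) (p : ℝ → E³ → ℝ) :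
    ∫⁻ w in parabolicCylinder r z, ‖p w.1 w.2 - ⨍ y in ball z.2 r, p w.1 y‖ₑ ^ (3 / 2 : ℝ) =
      ENNReal.ofReal r ^ 2 * cknDOsc r z p := by
  have hr2 : ENNReal.ofReal r ^ 2 ≠ 0 := pow_ne_zero _ (ENNReal.ofReal_pos.2 hr).ne'
  have hr2' : ENNReal.ofReal r ^ 2 ≠ ∞ := ENNReal.pow_ne_top ENNReal.ofReal_ne_top
  unfold cknDOsc
  rw [← mul_assoc, ENNReal.mul_inv_cancel hr2 hr2', one_mul]

/-- **The locally gauged pressure is `L^{3/2}` on the cylinder with the scale-invariant bound**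
`∫_{Q(z,r)} |p − [p]_{B(x,r)}|^{3/2} ≤ r² 𝐈` for every parabolic ball of the closed lower half
space. [cite: AlbrittonBarker2019, §1] -/
theorem lintegral_sub_ballMean_le_typeIBound {r : ℝ} (hr : 0 < r) {z : ℝ × E³} (hz : z.1 ≤ 0)
    (u : ℝ → E³ → E³) (p : ℝ → E³ → ℝ) (G : ℝ → E³ → E³ →L[ℝ] E³) :
    ∫⁻ w in parabolicCylinder r z, ‖p w.1 w.2 - ⨍ y in ball z.2 r, p w.1 y‖ₑ ^ (3 / 2 : ℝ) ≤
      ENNReal.ofReal r ^ 2 * typeIBound (Iio (0 : ℝ) ×ˢ (univ : Set E³)) u p G := by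
  rw [lintegral_sub_ballMean_eq hr]
  gcongr
  exact (cknDOsc_le_abScaledSum (u := u) (G := G)).trans
    (abScaledSum_le_typeIBound hr (parabolicCylinder_subset_lowerHalf hz r))

/-! ### Smooth representatives with a cylinder-dependent pressure gauge -/

/-- **Smooth representative with uniform derivative bounds, from local boundedness, the pressure
gauge being allowed to depend on the covering cylinder.**  Same statement and proof as the tree's
`exists_smooth_representative_of_locally_bounded` (Lemarié-Rieusset 2016, proof of Thm. 15.4,
Step 2, with Serrin's theory in the quantitative form `NSBoundedHigherRegularityBounds`), except
that for every point `(t, x)` of `Ω = ]a, b[ × S` the pair solving the equations in the covering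
cylinder `Q((min(t + ρ², b), x), 2ρ)` may have its own pressure `π_{(t,x)}`: the regularity
statement is about `w` only and the tree's proof consumes the pressure cylinder-wise.
[cite: LemarieRieusset2016, proof of Thm. 15.4, Step 2] -/
theorem exists_smooth_representative_of_locally_bounded_gauge (hB : NSBoundedHigherRegularityBounds)
    {w : ℝ → E³ → E³} {a b : ℝ} {S : Set E³} (hS : IsOpen S)
    {ρ M : ℝ} {P : ℝ≥0} (hρ : 0 < ρ)
    (hloc : ∀ z ∈ Ioo a b ×ˢ S, ∃ π : ℝ → E³ → ℝ,
      IsDistributionalNSSolutionOn (parabolicCylinderOpens (2 * ρ) (min (z.1 + ρ ^ 2) b, z.2)) 1 0 w π ∧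
      (∀ᵐ q ∂(volume.restrict (parabolicCylinder (2 * ρ) (min (z.1 + ρ ^ 2) b, z.2))),
        ‖w q.1 q.2‖ ≤ M) ∧
      ∫⁻ q in parabolicCylinder (2 * ρ) (min (z.1 + ρ ^ 2) b, z.2), ‖π q.1 q.2‖ₑ ^ (3 / 2 : ℝ) ≤ P)
    (N : ℕ) :
    ∃ (K : ℝ) (U : ℝ → E³ → E³),
      uncurry U =ᵐ[volume.restrict (Ioo a b ×ˢ S)] uncurry w ∧
      ContinuousOn (uncurry U) (Ioo a b ×ˢ S) ∧
      (∀ z ∈ Ioo a b ×ˢ S, ContDiffAt ℝ (⊤ : ℕ∞) (U z.1) z.2) ∧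
      (∀ n : ℕ, ContinuousOn (fun z : ℝ × E³ => iteratedFDeriv ℝ n (U z.1) z.2) (Ioo a b ×ˢ S)) ∧
      ∀ n ≤ N, ∀ z ∈ Ioo a b ×ˢ S, ‖iteratedFDeriv ℝ n (U z.1) z.2‖ ≤ K := by
  set Ω : Set (ℝ × E³) := Ioo a b ×ˢ S with hΩ
  have hΩo : IsOpen Ω := isOpen_Ioo.prod hS
  have hr : (3 / 2 * ρ) ∈ Ioo 0 (2 * ρ) := ⟨by positivity, by linarith⟩
  obtain ⟨K₀, hK₀⟩ := hB.exists_uniform_bound (2 * ρ) M P hr N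
  -- Step 1: local smooth representatives with the uniform bound
  have hloc' : ∀ z ∈ Ω, ∃ Tz : Set (ℝ × E³), IsOpen Tz ∧ z ∈ Tz ∧ Tz ⊆ Ω ∧ ∃ V : ℝ → E³ → E³,
      uncurry w =ᵐ[volume.restrict Tz] uncurry V ∧ ContinuousOn (uncurry V) Tz ∧
      (∀ z' ∈ Tz, ContDiffAt ℝ (⊤ : ℕ∞) (V z'.1) z'.2) ∧
      (∀ n : ℕ, ContinuousOn (fun z' : ℝ × E³ => iteratedFDeriv ℝ n (V z'.1) z'.2) Tz) ∧
      ∀ n ≤ N, ∀ z' ∈ Tz, ‖iteratedFDeriv ℝ n (V z'.1) z'.2‖ ≤ K₀ := by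
    rintro ⟨t, x⟩ ⟨ht, hx⟩
    set z₀ : ℝ × E³ := (min (t + ρ ^ 2) b, x) with hz₀
    obtain ⟨π, hsol, hbd, hP⟩ := hloc (t, x) ⟨ht, hx⟩
    obtain ⟨V, hae, hVc, hCD, hHol, hbdV⟩ := hK₀ w π z₀ hsol hbd hP
    have hsub : parabolicCylinder (3 / 2 * ρ) z₀ ⊆ parabolicCylinder (2 * ρ) z₀ := by
      intro q hq
      rw [mem_parabolicCylinder] at hq ⊢
      exact ⟨⟨by nlinarith [hq.1.1], hq.1.2⟩, hq.2.trans (by linarith)⟩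
    refine ⟨parabolicCylinder (3 / 2 * ρ) z₀ ∩ Ω, (isOpen_parabolicCylinder _ _).inter hΩo,
      ⟨mem_parabolicCylinder_top hρ ht.2, ht, hx⟩, inter_subset_right, V,
      ae_restrict_of_ae_restrict_of_subset (inter_subset_left.trans hsub) hae,
      hVc.mono (inter_subset_left.trans hsub), fun z' hz' => hCD z' (hsub hz'.1),
      fun n => ?_, fun n hn z' hz' => hbdV n hn z' hz'.1⟩
    obtain ⟨C, α, hα, hH⟩ := hHol n (3 / 2 * ρ) hr
    exact (hH.continuousOn hα).mono inter_subset_left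
  -- Step 2: glue
  have hloc'' : ∀ z ∈ Ω, ∃ Tz : Set (ℝ × E³), IsOpen Tz ∧ z ∈ Tz ∧ Tz ⊆ Ω ∧
      ∃ g : ℝ × E³ → E³, ContinuousOn g Tz ∧ uncurry w =ᵐ[volume.restrict Tz] g := by
    intro z hz
    obtain ⟨Tz, hTo, hzT, hTΩ, V, hae, hVc, -⟩ := hloc' z hz
    exact ⟨Tz, hTo, hzT, hTΩ, uncurry V, hVc, hae⟩
  obtain ⟨g, hg, hug⟩ := exists_continuousOn_ae_eq_of_locally (μ := volume) hloc''
  -- Step 3: the glued field agrees with the local representatives on their neighbourhoods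
  have hagree : ∀ {Tz : Set (ℝ × E³)} {V : ℝ → E³ → E³}, IsOpen Tz → Tz ⊆ Ω →
      uncurry w =ᵐ[volume.restrict Tz] uncurry V → ContinuousOn (uncurry V) Tz →
      EqOn (uncurry (curry g)) (uncurry V) Tz := by
    intro Tz V hTo hTΩ hae hVc
    have h1 : uncurry (curry g) =ᵐ[volume.restrict Tz] uncurry V := by
      have h3 : uncurry w =ᵐ[volume.restrict Tz] g := ae_restrict_of_ae_restrict_of_subset hTΩ hug
      simpa using h3.symm.trans hae
    refine Measure.eqOn_open_of_ae_eq h1 hTo ?_ hVc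
    simpa using hg.mono hTΩ
  refine ⟨K₀, curry g, ?_, ?_, fun z hz => ?_, fun n z hz => ?_, fun n hn z hz => ?_⟩
  · simpa using hug.symm
  · simpa using hg
  · obtain ⟨Tz, hTo, hzT, hTΩ, V, hae, hVc, hCD, -⟩ := hloc' z hz
    exact contDiffAt_of_eqOn hTo (hagree hTo hTΩ hae hVc) hzT (hCD z hzT)
  · obtain ⟨Tz, hTo, hzT, hTΩ, V, hae, hVc, -, hjc, -⟩ := hloc' z hz
    have heq := hagree hTo hTΩ hae hVc
    have h1 : ContinuousOn (fun z' : ℝ × E³ => iteratedFDeriv ℝ n (curry g z'.1) z'.2) Tz :=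
      (hjc n).congr fun z' hz' => iteratedFDeriv_slice_eq_of_eqOn hTo heq n hz'
    exact (h1.continuousAt (hTo.mem_nhds hzT)).continuousWithinAt
  · obtain ⟨Tz, hTo, hzT, hTΩ, V, hae, hVc, -, -, hbdV⟩ := hloc' z hz
    rw [iteratedFDeriv_slice_eq_of_eqOn hTo (hagree hTo hTΩ hae hVc) n hzT]
    exact hbdV n hn z hzT

/-! ### Slices below the final time are in `L⁴(ℝ³)` -/

/-- **The apex bound puts every slice below the final time in `L⁴(ℝ³)`**: if `f` is
a.e.-strongly measurable and `|f(y)| ≤ C/(‖y‖ + s)` a.e. with `s > 0`, then `f ∈ L⁴(ℝ³)`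
(`(‖y‖ + s)⁻¹ ≤ min(1, s)⁻¹ (1 + ‖y‖)⁻¹` and `(1 + ‖y‖)^{-4}` is integrable on `ℝ³`). [folklore] -/
theorem memLp_four_of_apex_bound {f : E³ → E³} (hf : AEStronglyMeasurable f volume) {C s : ℝ}
    (hs : 0 < s) (hb : ∀ᵐ y ∂(volume : Measure E³), ‖f y‖ ≤ C / (‖y‖ + s)) : MemLp f 4 volume := by
  set m : ℝ := min 1 s with hm
  have hmpos : 0 < m := lt_min one_pos hs
  set C' : ℝ := max C 0 / m with hC'
  have hC'0 : 0 ≤ C' := by positivity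
  -- the dominating function
  set g : E³ → ℝ := fun y => C' * (1 + ‖y‖) ^ (-(1 : ℝ)) with hg
  have hgc : Continuous g := by
    refine continuous_const.mul ?_
    exact (continuous_const.add continuous_norm).rpow_const fun y =>
      Or.inl (add_pos_of_pos_of_nonneg one_pos (norm_nonneg y)).ne'
  have hg4 : MemLp g 4 volume := by
    have hdim : (Module.finrank ℝ E³ : ℝ) < 4 := by rw [finrank_euclideanSpace_fin]; norm_num
    have hint : Integrable (fun y : E³ => (1 + ‖y‖) ^ (-(4 : ℝ))) volume := integrable_one_add_norm hdim
    have hint' : Integrable (fun y : E³ => ‖g y‖ ^ (4 : ℝ≥0∞).toReal) volume := by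
      have e : (fun y : E³ => ‖g y‖ ^ (4 : ℝ≥0∞).toReal) =
          fun y => C' ^ (4 : ℝ) * (1 + ‖y‖) ^ (-(4 : ℝ)) := by
        funext y
        have h1 : 0 < 1 + ‖y‖ := by positivity
        rw [ENNReal.toReal_ofNat, hg]
        dsimp only
        rw [Real.norm_of_nonneg (by positivity), Real.mul_rpow hC'0 (by positivity),
          ← Real.rpow_mul h1.le]
        norm_num
      rw [e]
      exact hint.const_mul _
    exact (integrable_norm_rpow_iff hgc.aestronglyMeasurable (by norm_num) (by norm_num)).1 hint'
  refine MemLp.of_le hg4 hf ?_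
  filter_upwards [hb] with y hy
  have h1 : 0 < 1 + ‖y‖ := by positivity
  have h2 : 0 < ‖y‖ + s := by positivity
  have hkey : m * (1 + ‖y‖) ≤ ‖y‖ + s := by
    have hm1 : m ≤ 1 := min_le_left _ _
    have hms : m ≤ s := min_le_right _ _
    nlinarith [norm_nonneg y]
  rw [hg]
  dsimp only
  rw [Real.norm_of_nonneg (by positivity), Real.rpow_neg h1.le, Real.rpow_one]
  calc ‖f y‖ ≤ C / (‖y‖ + s) := hy
    _ ≤ max C 0 / (‖y‖ + s) := div_le_div_of_nonneg_right (le_max_left _ _) h2.le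
    _ ≤ max C 0 / (m * (1 + ‖y‖)) := div_le_div_of_nonneg_left (le_max_right _ _) (by positivity) hkey
    _ = C' * (1 + ‖y‖)⁻¹ := by rw [hC']; field_simp

end Summit.NavierStokesRegularity.NavierStokesRegularity.Theorems.RellichScarNoMildScar

end
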